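import Mathlib
import Summits.NavierStokesRegularity.NavierStokesRegularity.Theorems.ThreadingFluxCentreJetTriaxialRigidityEvolution
import Summits.NavierStokesRegularity.NavierStokesRegularity.Theorems.ThreadingFluxCentreJetTriaxialFrameDegreeTwo
import HarnessLib

/-!
# Crux `PoloidalLiouville` (stmt-NavierStokesRegularity-1222, wall W1), crux idea «steady-centre-sieve» (ns-idea-15):
# POLHODE FORCING and the ORDER DICHOTOMY ALONG A CLASSICAL NAVIER–STOKES EVOLUTION

Support file (`--supports stmt-NavierStokesRegularity-1222`, helper; cell `ns-wall-extremal`, width hand ns-wall-eng-7 g7, 0 kit).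
The time-dependent companions of ns-wall-eng-7 g6's `CentreJet.polhodeForcing` (p698618) and `CentreJet.orderDichotomy` (p700053),
obtained from the order ladder of `ThreadingFluxCentreJetTriaxialRigidityEvolution.lean` (core step `diag_curl_eq_zero_of_lower_evolution`,
jet facts `jetFacts_of_lower_evolution`) and g6's degree-two frame algebra `TriaxialFrame.eq_smul_cross_of_jetFacts_two` (p698141) BY NAME.

Setting: `(u, p)` a classical Navier–Stokes solution (`ν = 1`, no force) on a time set `S` of unique differentiability with
`S ⊆ closure (interior S)`; at every `t ∈ S`, `u(t)` is real-analytic on `ball x₀ ρ`, unthreaded about `x₀` there, `u(t)(x₀) = 0`, and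
`Du(t)(x₀)` has an orthonormal eigenframe with three distinct eigenvalues (t-dependent).  NO hypothesis on the vorticity 2-jet.

* `diag_lt_two_eq_zero_evolution`, `fderiv_curl_centre_eq_zero_evolution` — the vorticity 1-JET VANISHES at `x₀` at every time
  (degrees `0` and `1` of the ladder: `k = 0, 1 ≠ 2`);
* `polhodeForcing_evolution_of_timeSet` / `polhodeForcing_evolution` (Ioo form, binders shaped like the Defs Prop `PolhodeForcing` with
  `V := u t`) — at every time the vorticity 2-jet is a multiple `μ(t)` of the Euler-top (polhode) field of the strain,
  `D²(curl u(t))(x₀)(y, y) = μ(t) · y × Du(t)(x₀) y`;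
* `orderDichotomy_evolution_of_timeSet` — EITHER `curl u(t) ≡ 0` on the ball at every time, OR some time carries a non-zero polhode 2-jet
  (`μ(t) ≠ 0`).

HONEST FRAME: information-grade helper on the structure of the CentreJet line (non-generic hypotheses; nothing bounded/ancient/mild used);
closes no crux or sketch Prop; C1/C1*/C1″ untouched; `PoloidalLiouville` (1222) and NS regularity OPEN; movement on the wall: 0.
-/

-- the summit and its single sub-problem share the name (CONVENTIONS §1)
set_option linter.dupNamespace false

noncomputable section

namespace Summit.NavierStokesRegularity.NavierStokesRegularity.Theorems.PoloidalLiouville.CentreJet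

open Set Function Filter Topology Metric
open scoped ContDiff RealInnerProductSpace
open Literature.Analysis.FluidPDE

variable {S : Set ℝ} {u : ℝ → E3 → E3} {p : ℝ → E3 → ℝ} {x₀ : E3} {ρ : ℝ}

/-- **Degrees `0` and `1` of the ladder**: along such an evolution the diagonal Taylor terms of `curl (u s)` at `x₀` of degree `< 2` vanish
at every time. -/
theorem diag_lt_two_eq_zero_evolution (hS : UniqueDiffOn ℝ S) (hcl : S ⊆ closure (interior S))
    (hNS : IsClassicalNSSolutionOn S 1 0 u p) (hρ : 0 < ρ) (han : ∀ t ∈ S, AnalyticOnNhd ℝ (u t) (ball x₀ ρ))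
    (hun : ∀ t ∈ S, ∀ x ∈ ball x₀ ρ, ⟪x - x₀, curl (u t) x⟫ = 0) (h0 : ∀ t ∈ S, u t x₀ = 0)
    (hframe : ∀ t ∈ S, ∃ (b : Fin 3 → E3) (e : Fin 3 → ℝ), Orthonormal ℝ b ∧ Function.Injective e ∧
      ∀ i, fderiv ℝ (u t) x₀ (b i) = e i • b i) :
    ∀ n < 2, ∀ s ∈ S, ∀ y : E3, iteratedFDeriv ℝ n (curl (u s)) x₀ (fun _ => y) = 0 := by
  have hd0 : ∀ s ∈ S, ∀ y : E3, iteratedFDeriv ℝ 0 (curl (u s)) x₀ (fun _ => y) = 0 :=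
    diag_curl_eq_zero_of_lower_evolution hS hcl hNS hρ han hun h0 hframe (k := 0) (by norm_num)
      (fun n hn => absurd hn (Nat.not_lt_zero n))
  have hd1 : ∀ s ∈ S, ∀ y : E3, iteratedFDeriv ℝ 1 (curl (u s)) x₀ (fun _ => y) = 0 :=
    diag_curl_eq_zero_of_lower_evolution hS hcl hNS hρ han hun h0 hframe (k := 1) (by norm_num) (fun n hn s hs y => by
      obtain rfl : n = 0 := by omega
      exact hd0 s hs y)
  intro n hn
  rcases Nat.lt_succ_iff_lt_or_eq.mp hn with hn' | rfl
  · obtain rfl : n = 0 := by omega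
    exact hd0
  · exact hd1

/-- **The vorticity 1-jet vanishes at the centre at every time** — the «type N» alternative (`Δu(t)(x₀) ≠ 0`) cannot occur along a
zero-drift triaxial unthreaded evolution. -/
theorem fderiv_curl_centre_eq_zero_evolution (hS : UniqueDiffOn ℝ S) (hcl : S ⊆ closure (interior S))
    (hNS : IsClassicalNSSolutionOn S 1 0 u p) (hρ : 0 < ρ) (han : ∀ t ∈ S, AnalyticOnNhd ℝ (u t) (ball x₀ ρ))
    (hun : ∀ t ∈ S, ∀ x ∈ ball x₀ ρ, ⟪x - x₀, curl (u t) x⟫ = 0) (h0 : ∀ t ∈ S, u t x₀ = 0)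
    (hframe : ∀ t ∈ S, ∃ (b : Fin 3 → E3) (e : Fin 3 → ℝ), Orthonormal ℝ b ∧ Function.Injective e ∧
      ∀ i, fderiv ℝ (u t) x₀ (b i) = e i • b i) :
    ∀ t ∈ S, fderiv ℝ (curl (u t)) x₀ = 0 := by
  intro t ht
  refine ContinuousLinearMap.ext fun y => ?_
  have h := diag_lt_two_eq_zero_evolution hS hcl hNS hρ han hun h0 hframe 1 (by norm_num) t ht y
  simpa using h

/-- ★ **Polhode forcing along an evolution** (general time set): at every `t ∈ S` the vorticity 1-jet vanishes and the vorticity 2-jet is a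
multiple of the Euler-top field of the strain, `D²(curl u(t))(x₀)(y, y) = μ • (y × Du(t)(x₀) y)`. -/
theorem polhodeForcing_evolution_of_timeSet (hS : UniqueDiffOn ℝ S) (hcl : S ⊆ closure (interior S))
    (hNS : IsClassicalNSSolutionOn S 1 0 u p) (hρ : 0 < ρ) (han : ∀ t ∈ S, AnalyticOnNhd ℝ (u t) (ball x₀ ρ))
    (hun : ∀ t ∈ S, ∀ x ∈ ball x₀ ρ, ⟪x - x₀, curl (u t) x⟫ = 0) (h0 : ∀ t ∈ S, u t x₀ = 0)
    (hframe : ∀ t ∈ S, ∃ (b : Fin 3 → E3) (e : Fin 3 → ℝ), Orthonormal ℝ b ∧ Function.Injective e ∧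
      ∀ i, fderiv ℝ (u t) x₀ (b i) = e i • b i) :
    ∀ t ∈ S, fderiv ℝ (curl (u t)) x₀ = 0 ∧
      ∃ μ : ℝ, ∀ y : E3, fderiv ℝ (fderiv ℝ (curl (u t))) x₀ y y = μ • cross y (fderiv ℝ (u t) x₀ y) := by
  intro t ht
  refine ⟨fderiv_curl_centre_eq_zero_evolution hS hcl hNS hρ han hun h0 hframe t ht, ?_⟩
  obtain ⟨hdivP, htanP, hharmP, hloopP⟩ := jetFacts_of_lower_evolution hS hcl hNS hρ han hun h0 (k := 2)
    (diag_lt_two_eq_zero_evolution hS hcl hNS hρ han hun h0 hframe) ht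
  obtain ⟨b, e, hb, he, hSb⟩ := hframe t ht
  have htr : ∑ i, e i = 0 := sum_eigen_eq_zero_of_divergence (hNS.divFree t ht x₀) hb hSb
  obtain ⟨μ, hμ⟩ := TriaxialFrame.eq_smul_cross_of_jetFacts_two (fun y : E3 => iteratedFDeriv ℝ 2 (curl (u t)) x₀ (fun _ => y))
    (JetCalculus.contDiff_diag 2) (fun c y => JetCalculus.diag_smul 2 c y) hdivP htanP hharmP (fderiv ℝ (u t) x₀) b e hb he hSb htr
    hloopP
  refine ⟨μ, fun y => ?_⟩
  have h := hμ y
  rw [iteratedFDeriv_two_apply] at h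
  exact h

/-- ★ **Polhode forcing along an evolution** (open time interval; binders shaped like the Defs Prop `PolhodeForcing` with `V := u t` at every
time, the steady equation replaced by the classical evolution class of E2′): for a classical Navier–Stokes evolution `(u, p)` (`ν = 1`, no
force) on `(t₀, t₁) × ℝ³` with `u(t)` real-analytic and unthreaded about `x₀` on `ball x₀ ρ`, `u(t)(x₀) = 0` and a triaxial orthonormal
eigenframe of `Du(t)(x₀)` at every time: `D(curl u(t))(x₀) = 0` and `D²(curl u(t))(x₀)(y, y) = μ(t) • (y × Du(t)(x₀) y)` at every time. -/
theorem polhodeForcing_evolution :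
    ∀ (u : ℝ → E3 → E3) (p : ℝ → E3 → ℝ) (x₀ : E3) (ρ t₀ t₁ : ℝ), 0 < ρ → t₀ < t₁ →
      IsClassicalNSSolutionOn (Ioo t₀ t₁) 1 0 u p →
      (∀ t ∈ Ioo t₀ t₁, AnalyticOnNhd ℝ (u t) (Metric.ball x₀ ρ)) →
      (∀ t ∈ Ioo t₀ t₁, ∀ x ∈ Metric.ball x₀ ρ, inner ℝ (x - x₀) (curl (u t) x) = 0) →
      (∀ t ∈ Ioo t₀ t₁, u t x₀ = 0) →
      (∀ t ∈ Ioo t₀ t₁, ∃ (b : Fin 3 → E3) (e : Fin 3 → ℝ), Orthonormal ℝ b ∧ Function.Injective e ∧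
        ∀ i, fderiv ℝ (u t) x₀ (b i) = e i • b i) →
      ∀ t ∈ Ioo t₀ t₁, fderiv ℝ (curl (u t)) x₀ = 0 ∧
        ∃ μ : ℝ, ∀ y : E3, fderiv ℝ (fderiv ℝ (curl (u t))) x₀ y y = μ • cross y (fderiv ℝ (u t) x₀ y) := by
  intro u p x₀ ρ t₀ t₁ hρ _ hNS han hun h0 hframe
  exact polhodeForcing_evolution_of_timeSet isOpen_Ioo.uniqueDiffOn (by rw [interior_Ioo]; exact subset_closure) hNS hρ han hun
    h0 hframe

/-- ★ **Order dichotomy along an evolution**: EITHER the flow is irrotational on the ball at every time of `S`, OR at some time the vorticity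
2-jet at `x₀` is a NON-ZERO multiple of the polhode field of the strain. -/
theorem orderDichotomy_evolution_of_timeSet (hS : UniqueDiffOn ℝ S) (hcl : S ⊆ closure (interior S))
    (hNS : IsClassicalNSSolutionOn S 1 0 u p) (hρ : 0 < ρ) (han : ∀ t ∈ S, AnalyticOnNhd ℝ (u t) (ball x₀ ρ))
    (hun : ∀ t ∈ S, ∀ x ∈ ball x₀ ρ, ⟪x - x₀, curl (u t) x⟫ = 0) (h0 : ∀ t ∈ S, u t x₀ = 0)
    (hframe : ∀ t ∈ S, ∃ (b : Fin 3 → E3) (e : Fin 3 → ℝ), Orthonormal ℝ b ∧ Function.Injective e ∧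
      ∀ i, fderiv ℝ (u t) x₀ (b i) = e i • b i) :
    (∀ t ∈ S, ∀ x ∈ ball x₀ ρ, curl (u t) x = 0) ∨
      ∃ t ∈ S, ∃ μ : ℝ, μ ≠ 0 ∧ ∀ y : E3, fderiv ℝ (fderiv ℝ (curl (u t))) x₀ y y = μ • cross y (fderiv ℝ (u t) x₀ y) := by
  by_cases hall : ∀ t ∈ S, ∀ y : E3, iteratedFDeriv ℝ 2 (curl (u t)) x₀ (fun _ => y) = 0
  · exact Or.inl (curl_eq_zero_of_diag_two_evolution hS hcl hNS hρ han hun h0 hframe hall)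
  · right
    obtain ⟨t, ht, y₁, hy₁⟩ : ∃ t ∈ S, ∃ y : E3, iteratedFDeriv ℝ 2 (curl (u t)) x₀ (fun _ => y) ≠ 0 := by
      by_contra hne
      apply hall
      intro t ht y
      by_contra hy
      exact hne ⟨t, ht, y, hy⟩
    obtain ⟨-, μ, hμ⟩ := polhodeForcing_evolution_of_timeSet hS hcl hNS hρ han hun h0 hframe t ht
    refine ⟨t, ht, μ, ?_, hμ⟩
    rintro rfl
    apply hy₁
    rw [iteratedFDeriv_two_apply, hμ y₁, zero_smul]

end Summit.NavierStokesRegularity.NavierStokesRegularity.Theorems.PoloidalLiouville.CentreJet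

end
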